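import Mathlib
import HarnessLib
import Summits.HubbardSuperconductivity.HubbardSuperconductivity.Theorems.KLProgrammeKLRegimeEngineTowerLevLawOfInputsScaledDisc

/-!
# Route `KLProgramme` — crux K3 ENGINE (stmt-HubbardSuperconductivity-20437 `KLRegimeEngineV17F2`), stub (b) v2, THE LEVELS PACKAGE (ℓ):
# THE LEVELLED TOWER LAW FROM NAMED INPUTS, NAMED UV ARRAY `μ0` AT BLOCK 0, UV AMPLITUDE OF THE `R`-ROWS DISCOUNTED BY `B⁻²`
# (cell gate-hubbard-kl, seat hubbard-kl-k3c3-p2 g14, located «(I5)-UV-DISCOUNT»; twin of p4 g18's `klTowerBLev_le_law_of_inputs_uv` (…LevLawOfInputsUV, p664643) —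
# E1's (I5)/(I7)-LEV by the substitute precedent; E1 / p4 may rename or supersede)

`klTowerBLev_le_law_of_inputs_uv` (p4 g18's assembly point of record: block `0` read through a NAMED trivial-family UV array `μ0`, blocks `k ≥ 1` through the scaled
measured array `W·Z^m·klTowerMuLev … d k m`, hstep supplied per block by `klTowerBLev_one_le_kitStep` / `klTowerBLev_succ_le_kitStep`) reads the UV datum INSIDE the
re-measured blocks `k ≥ 1` at the law parameter `λ ≥ ε₀ := epsCoupling P U 0`, i.e. at `B = 1`: its floor `A′ ≥ W·27⁵(C₁/C₂)8^{d−1}(ε_x + A/(1−(√2^d)⁻¹))` with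
`Q′ ≥ Z·C₂²(2^{d−1})⁻¹·max Q (CE/ε_x²)` and `Q ≥ 4Q′` makes the kit's λ-free amplitude row `hy` (⇒ `Φ·τ·A′·Q′ < 2`) the parameter-free condition
`Φ·τ·W·Z²·27⁵·C₁C₂·4^d·Qe.CE < 2ε_x` — not dischargeable (k3c2-p3 g13, KL STATUS l.9397: `≈ 1.36×10¹³·(αε_x4^{−dk})·CE < 2` on the tree's scalings).  The blocked
tower's design has the amplitude free downward through `B` (`λ = B·ε`, E1-TOWER-BLOCKED §9 (ii)); this twin threads it exactly as `klTowerBLev_le_law_of_inputs_scaled_disc`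
(…LevLawOfInputsScaledDisc) does for the `_scaled` assembly: law parameter `λ ≥ B·ε₀`, `B ≥ 1`, `R`-rows through `klTowerMuLev_le_profileR_of_levelZero_disc`
(…InstUVLevDisc), floors **`A′ ≥ W·27⁵·ε_x/B²`, `A′ ≥ W·27⁵(C₁/C₂)8^{d−1}(ε_x/B² + A/(1−(√2^d)⁻¹))`**; everything else VERBATIM `klTowerBLev_le_law_of_inputs_uv`
(the block-`0` array `μ0` with its profile and imports, the step in the `if k = 0 then μ0 else …` shape, the cell, the kit's numerics).

* **`klTowerBLev_le_law_of_inputs_uv_disc`** — ⊢ `∀ k ≤ K_b, ∀ t, ∀ 3 ≤ p ≤ D, klTowerBLev … d t k p ≤ A λ^{p−1} Q^p`.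
Composition of landed theorems; nothing about the model is asserted beyond them and the named inputs; nothing asserts (ℓ), any stub, K3 or superconductivity.
References: BGM 2006 §2.8 (2.83), (2.93)–(2.98) [cite: BenfattoGiulianiMastropietro2006].
-/

noncomputable section

namespace Summit.HubbardSuperconductivity.HubbardSuperconductivity.Theorems.EngineV8

set_option linter.dupNamespace false -- summit = problem name (single-conjunct summit), D-0017

open Classical
open Real Finset Literature.MathematicalPhysics.QuantumLattice Literature.Probability.LatticeModels GrassmannAlgebra
open Literature.MathematicalPhysics.QuantumLattice.FermiRG
open Summit.HubbardSuperconductivity.HubbardSuperconductivity.Theorems.KLProgrammeLegKernels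
open Summit.HubbardSuperconductivity.HubbardSuperconductivity.Theorems.KLRegimeSplit
open Summit.HubbardSuperconductivity.HubbardSuperconductivity.Theorems.KLRegimeWick
open Summit.HubbardSuperconductivity.HubbardSuperconductivity.Theorems.TorusFourierL2
open Summit.HubbardSuperconductivity.HubbardSuperconductivity.Theorems.DispersionFlow
open Summit.HubbardSuperconductivity.HubbardSuperconductivity.Theorems.PerturbedFermiCurve

/-- **THE LEVELLED TOWER LAW FROM NAMED INPUTS, named UV array at block `0`, scaled measured array at `k ≥ 1`, UV amplitude of the `R`-rows discounted**
(`1 ≤ B`, `B·epsCoupling P U 0 ≤ λ`; see the module docstring). [cite: BenfattoGiulianiMastropietro2006, §2.8 (2.83), (2.93)-(2.98)] -/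
theorem klTowerBLev_le_law_of_inputs_uv_disc :
    ∃ C₁ C₂ : ℝ, 0 < C₁ ∧ 0 < C₂ ∧ ∀ R : RenConsts, R.WF2 → ∃ c₃' : ℝ, 0 < c₃' ∧ ∃ U₀' : ℝ, 0 < U₀' ∧
      ∀ (P : SplitConsts) (c : ℝ), P.WF → 0 < c → c ≤ klEngC₃6 P R → c ≤ c₃' →
      ∀ μ ∈ klWindowC, ∀ U : ℝ, 0 < U → U ≤ klEngU₀9 P R c → U ≤ U₀' → ∀ β : ℝ, klBetaMin ≤ β → β ≤ Real.exp (c / U ^ 2) →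
      ∀ K : TrigPolyC4v, FrameOK R U (nScales β) μ K → ∀ (L M : ℕ) [NeZero L] [NeZero M],
      klEngL₃ β U ≤ L → klEngM₃ β U L ≤ M → ∀ d Kb D : ℕ, 2 ≤ d → d * Kb - 1 ≤ nScales β + 1 → 3 ≤ D →
      ∀ (Qe : EngConsts), 0 ≤ Qe.CE → KernelNormsLevels L M P Qe β U μ K 0 →
      ∀ (A lam Q B : ℝ), 0 ≤ A → 0 < Q → 1 ≤ B → B * epsCoupling P U 0 ≤ lam →
      ∀ (W Z A' Q' : ℝ), 0 < W → 0 < Z → W * ((27 : ℝ) ^ 5 * (imagTimeWeight β M / B ^ 2)) ≤ A' →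
        W * ((27 : ℝ) ^ 5 * (C₁ / C₂) * (8 : ℝ) ^ (d - 1) * (imagTimeWeight β M / B ^ 2 + A / (1 - (Real.sqrt 2 ^ d)⁻¹))) ≤ A' →
        Z * (Qe.CE / imagTimeWeight β M ^ 2) ≤ Q' → Z * (C₂ ^ 2 * ((2 : ℝ) ^ (d - 1))⁻¹ * max Q (Qe.CE / imagTimeWeight β M ^ 2)) ≤ Q' → 0 < Q' →
      ∀ (σ Φ ψ τ ι₁ ι₂ ι₃ X : ℝ), 0 ≤ σ → 0 ≤ Φ → 0 ≤ ψ → 0 < τ → W * Z ^ 3 * X ≤ ι₃ → A' * Q' ^ 3 ≤ ι₃ →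
      -- the UV array of block 0 (trivial family) and its profile (E1 (I3))
      ∀ μ0 : ℕ → ℝ, (∀ m, 0 ≤ μ0 m) → (∀ m, 3 ≤ m → m ≤ D → μ0 m ≤ A' * lam ^ (m - 1) * Q' ^ m) → μ0 3 ≤ ι₃ * lam ^ 2 →
      -- the imports (E1 (I4))
      (∀ k < Kb, (if k = 0 then μ0 1 else W * Z ^ 1 * klTowerMuLev L M β U μ K d k 1) ≤ ι₁ * lam) →
      (∀ k < Kb, (if k = 0 then μ0 2 else W * Z ^ 2 * klTowerMuLev L M β U μ K d k 2) ≤ ι₂ * lam) →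
      -- the located six-leg cell «(I2)-F1-HMU»
      (∀ k, 1 ≤ k → k < Kb → klTowerMuLevAt L M β U μ K d 0 k 3 ≤ X * lam ^ 2) →
      -- the step (block 0: k3c2-p3's «(I1)-BLOCK0» rows at `μ0`; blocks k ≥ 1: `klTowerBLev_succ_le_kitStep` at `W·Z^m·klTowerMuLev`; E1 (I1)/(I5))
      (∀ t : Fin 5, ∀ k < Kb, ∀ N : ℕ, 2 ≤ N → ∀ p, 3 ≤ p → p ≤ D →
        Φ * towerV D τ (fun m => if k = 0 then μ0 m else W * Z ^ m * klTowerMuLev L M β U μ K d k m) < 1 →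
        klTowerBLev L M β U μ K d t (k + 1) p ≤
          towerFO D σ (fun m => if k = 0 then μ0 m else W * Z ^ m * klTowerMuLev L M β U μ K d k m) p +
            ∑ n ∈ Icc 2 N, exp 1 * Φ ^ (n - 1) * ψ ^ p *
              towerS D τ (fun m => if k = 0 then μ0 m else W * Z ^ m * klTowerMuLev L M β U μ K d k m) n p +
            ψ ^ p * exp 1 * towerV D τ (fun m => if k = 0 then μ0 m else W * Z ^ m * klTowerMuLev L M β U μ K d k m) *
              (Φ * towerV D τ (fun m => if k = 0 then μ0 m else W * Z ^ m * klTowerMuLev L M β U μ K d k m)) ^ N /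
              (1 - Φ * towerV D τ (fun m => if k = 0 then μ0 m else W * Z ^ m * klTowerMuLev L M β U μ K d k m))) →
      -- the kit's numerics (E1 (I5))
      4 * σ * lam * Q' < 1 → 2 * lam * τ * Q' ≤ 1 → exp 1 * τ * lam * Q' < 1 →
      Φ * (τ * (ι₁ * lam + ι₂ / (2 * Q') + ι₃ / (4 * Q' ^ 2) + A' * Q' / 4)) < 1 →
      Φ * (exp 1 * τ * (ι₁ * lam) + (exp 1 * τ) ^ 2 * (ι₂ * lam) + (exp 1 * τ) ^ 3 * (ι₃ * lam ^ 2) +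
        A' * (exp 1 * τ * Q') * ((exp 1 * τ * lam * Q') ^ 3 / (1 - exp 1 * τ * lam * Q'))) < 1 →
      4 * Q' ≤ Q → 2 * τ * ψ * Q' ≤ Q →
      A' * (4 * Q') ^ 3 * (4 * σ * lam * Q' / (1 - 4 * σ * lam * Q')) +
        exp 1 * ψ * (2 * τ * ψ * Q') ^ 2 * (τ * (ι₁ * lam + ι₂ / (2 * Q') + ι₃ / (4 * Q' ^ 2) + A' * Q' / 4)) *
          (Φ * (τ * (ι₁ * lam + ι₂ / (2 * Q') + ι₃ / (4 * Q' ^ 2) + A' * Q' / 4)) /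
            (1 - Φ * (τ * (ι₁ * lam + ι₂ / (2 * Q') + ι₃ / (4 * Q' ^ 2) + A' * Q' / 4)))) ≤ A * Q ^ 3 →
      ∀ k ≤ Kb, ∀ (t : Fin 5) (p : ℕ), 3 ≤ p → p ≤ D → klTowerBLev L M β U μ K d t k p ≤ A * lam ^ (p - 1) * Q ^ p := by
  obtain ⟨C₁, C₂, hC₁, hC₂, h⟩ := klTowerMuLev_le_profileR_of_levelZero_disc
  refine ⟨C₁, C₂, hC₁, hC₂, fun R hR2 => ?_⟩
  obtain ⟨c₃, hc₃, U₀, hU₀, h'⟩ := h R hR2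
  refine ⟨c₃, hc₃, U₀, hU₀, ?_⟩
  intro P c hP hc hc6 hc₃' μ hμ U hU hU9 hU₀' β hβmin hβc K hK L M _ _ hL3 hM3 d Kb D hd hKbN hD Qe hCE h0 A lam Q B hA hQ hB hεl W Z A' Q' hW hZ hA'1 hA'2
    hQ'1 hQ'2 hQ'0 σ Φ ψ τ ι₁ ι₂ ι₃ X hσ hΦ hψ hτ hXι hAQι μ0 hμ0 hμ0prof hμ03 hι₁ hι₂ hcell hstep hx₁ hx₂ hx₃ hy hθ hu₁ hu₂ hclose
  have hβ : 0 < β := KLRegimeSplit.pos_of_klBetaMin_le hβmin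
  have hK1 : 1 ≤ P.Klam := hP.1
  have hε0 : 0 < epsCoupling P U 0 := by
    unfold epsCoupling
    have : 0 < |U| + U ^ 2 * (0 : ℕ) := by simp [abs_pos.2 hU.ne']
    positivity
  have hB0 : 0 < B := lt_of_lt_of_le one_pos hB
  have hlam : 0 < lam := lt_of_lt_of_le (mul_pos hB0 hε0) hεl
  have hx : 0 < imagTimeWeight β M := by
    unfold imagTimeWeight
    have : (0 : ℝ) < M := Nat.cast_pos.2 (Nat.pos_of_ne_zero (NeZero.ne M))
    positivity
  have hA'0 : 0 ≤ A' := le_trans (by positivity) hA'1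
  have hQuv0 : 0 ≤ Qe.CE / imagTimeWeight β M ^ 2 := by positivity
  -- the profile constants of the `R` rows and their domination by `A′, Q′`
  set AR : ℝ := (27 : ℝ) ^ 5 * (C₁ / C₂) * (8 : ℝ) ^ (d - 1) * (imagTimeWeight β M / B ^ 2 + A / (1 - (Real.sqrt 2 ^ d)⁻¹)) with hAR
  set QR : ℝ := C₂ ^ 2 * ((2 : ℝ) ^ (d - 1))⁻¹ * max Q (Qe.CE / imagTimeWeight β M ^ 2) with hQR
  have hρ1 : (Real.sqrt 2 ^ d)⁻¹ < 1 := by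
    have hs1 : 1 ≤ Real.sqrt 2 := Real.one_le_sqrt.2 (by norm_num)
    have h2 : Real.sqrt 2 ^ 2 = 2 := Real.sq_sqrt (by norm_num)
    have : (1 : ℝ) < Real.sqrt 2 ^ d := by
      calc (1 : ℝ) < 2 := by norm_num
        _ = Real.sqrt 2 ^ 2 := h2.symm
        _ ≤ Real.sqrt 2 ^ d := pow_le_pow_right₀ hs1 hd
    exact inv_lt_one_of_one_lt₀ this
  have hAR0 : 0 ≤ AR := by
    have : 0 ≤ A / (1 - (Real.sqrt 2 ^ d)⁻¹) := div_nonneg hA (sub_nonneg.2 hρ1.le)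
    positivity
  have hQR0 : 0 ≤ QR := by
    have : 0 ≤ max Q (Qe.CE / imagTimeWeight β M ^ 2) := le_max_of_le_left hQ.le
    positivity
  have hdom : ∀ m : ℕ, W * Z ^ m * (AR * lam ^ (m - 1) * QR ^ m) ≤ A' * lam ^ (m - 1) * Q' ^ m := fun m => by
    rw [show W * Z ^ m * (AR * lam ^ (m - 1) * QR ^ m) = W * AR * lam ^ (m - 1) * (Z * QR) ^ m by rw [mul_pow]; ring]
    exact mul_le_mul (mul_le_mul_of_nonneg_right hA'2 (pow_nonneg hlam.le _)) (pow_le_pow_left₀ (by positivity) hQ'2 m)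
      (pow_nonneg (by positivity) _) (by positivity)
  have hWZ : ∀ m : ℕ, 0 ≤ W * Z ^ m := fun m => by positivity
  -- the kit's block-wise conditions from the rows
  have hkN : ∀ k, k < Kb → d * k - 1 ≤ nScales β + 1 := fun k hk =>
    le_trans (Nat.sub_le_sub_right (Nat.mul_le_mul_left d hk.le) 1) hKbN
  refine towerBorn_le_law_tracks_of_profile (T := Fin 5) (K := Kb) (D := D) (b := fun t k p => klTowerBLev L M β U μ K d t k p)
    (μ := fun k m => if k = 0 then μ0 m else W * Z ^ m * klTowerMuLev L M β U μ K d k m) (A := A) (lam := lam) (Q := Q) (A' := A') (Q' := Q')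
    (ι₃ := ι₃) hlam hQ.le hσ hΦ hψ hτ hQ'0 hA'0
    (fun k m => by
      by_cases hk0 : k = 0
      · simp only [hk0, if_true]; exact hμ0 m
      · simp only [hk0, if_false]; exact mul_nonneg (hWZ m) (klTowerMuLev_nonneg hβ U μ K d k m)) ?_ ?_ ?_
    hι₁ hι₂ hstep hx₁ hx₂ hx₃ hy hθ hu₁ hu₂ hclose
  · -- `h0`: the born array vanishes at block `0`
    intro t p _ _
    rw [klTowerBLev_zero]
    positivity
  · -- `hprof`: block `0` from the level-zero package, blocks `k ≥ 1` from the `R` rows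
    intro k hk ih m hm hmD
    rcases Nat.eq_zero_or_pos k with rfl | hk1
    · simp only [if_true]; exact hμ0prof m (by omega) hmD
    · simp only [show k ≠ 0 by omega, if_false]
      have hrow := h' P c hP hc hc6 hc₃' μ hμ U hU hU9 hU₀' β hβmin hβc K hK L M hL3 hM3 d k hd hk1 (hkN k hk) D Qe hCE h0 A lam Q B hA hQ.le hB hεl
        (fun k' _ hk'k t p hp hpD => ih k' hk'k t p hp hpD)
      exact (mul_le_mul_of_nonneg_left (hrow.1 m hm hmD) (hWZ m)).trans (hdom m)
  · -- `hprof3`: the same at six legs, the `t = 0` cell taken from the named input `X`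
    intro k hk hD3 ih
    rcases Nat.eq_zero_or_pos k with rfl | hk1
    · simp only [if_true]; exact hμ03
    · simp only [show k ≠ 0 by omega, if_false]
      have hrow := h' P c hP hc hc6 hc₃' μ hμ U hU hU9 hU₀' β hβmin hβc K hK L M hL3 hM3 d k hd hk1 (hkN k hk) D Qe hCE h0 A lam Q B hA hQ.le hB hεl
        (fun k' _ hk'k t p hp hpD => ih k' hk'k t p hp hpD)
      refine (mul_le_mul_of_nonneg_left (hrow.2 (X * lam ^ 2) hD3 (hcell k hk1 hk)) (hWZ 3)).trans ?_
      rw [mul_max_of_nonneg _ _ (hWZ 3)]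
      refine max_le ?_ ?_
      · calc W * Z ^ 3 * (X * lam ^ 2) = W * Z ^ 3 * X * lam ^ 2 := by ring
          _ ≤ ι₃ * lam ^ 2 := mul_le_mul_of_nonneg_right hXι (sq_nonneg _)
      · calc W * Z ^ 3 * (AR * lam ^ 2 * QR ^ 3) = W * Z ^ 3 * (AR * lam ^ (3 - 1) * QR ^ 3) := by norm_num
          _ ≤ A' * lam ^ (3 - 1) * Q' ^ 3 := hdom 3
          _ = A' * Q' ^ 3 * lam ^ 2 := by ring
          _ ≤ ι₃ * lam ^ 2 := mul_le_mul_of_nonneg_right hAQι (sq_nonneg _)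

end Summit.HubbardSuperconductivity.HubbardSuperconductivity.Theorems.EngineV8

end
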